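import Summits.NavierStokesRegularity.FunctionalMining.RateBudgets
import Summits.NavierStokesRegularity.FunctionalMining.Lyapunov
import Summits.NavierStokesRegularity.FunctionalMining.QuadraticBudgetStatic
import Summits.NavierStokesRegularity.FunctionalMining.QuadraticBudgetRefutation
import Literature.Analysis.FluidPDE.TorusClassicalHnBalance
import Literature.Analysis.FluidPDE.ExtremeGrowthVorticityControl
import Literature.Analysis.FluidPDE.TorusStrainVorticityIsometry
import Literature.Analysis.FluidPDE.TorusEnstrophyDissipationLowerBound
import Literature.Analysis.FluidPDE.MillerMiddleEigenvalueTorus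

/-!
# Functional mining for 3D Navier–Stokes: the typed first class 𝒦₁ (candidates, conventions)

Search for candidate a priori estimates; no regularity claim.

Cell `pub-nsfunc`, dictionary seat (DICTIONARY.md v1.3 §14, dict/K0.json, K0-SPEC κ-convention, dict/LADDER-K1Q0.md).
This file TYPES — never asserts — the handful of statements the census can at most suggest and a
prover would then have to settle, in the tree's own setting (zero-mean classical solutions of
unforced Navier–Stokes on the unit 3-torus, `FunctionalMining/RateBudgets`):

* `SaturatingLaw F σ γ κ` — the Lu–Doering-type law `dF/dt ≤ κ ν^{-γ} (2ℰ) F^{1+1/σ}` in the ONE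
  κ-convention of the bundle (REFEREE F4.2): κ is the RATE constant, so the law is MONOTONE IN κ
  (`SaturatingLaw.mono_kappa`: larger κ = weaker statement) and the census reports the smallest
  violation-free κ as a lower bound for the optimal constant. Calibration:
  `saturatingLaw_enstrophy_iff` — for `F = ℰ`, `σ = 1`, `γ = 3`, `κ = 27/(16π⁴) = C_LD·ν³/2` the law
  IS the tree's named fact `LuDoering2008_enstrophyRate_le` (nothing asserted about the fact).
* `StretchingSupBound C` — the STATIC inequality `∫⟪(v·∇)v, Δv⟫ ≤ C·M·ℰ(v)` for smooth
  divergence-free `v` with `|ω| ≤ M` pointwise (NOGO N2: degree-one rate rows are static field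
  inequalities); `EnstrophyRateSupBound C` — its dynamic form, literally Doering–Gibbon's named fact
  at `C = 2` (`enstrophyRateSupBound_two_iff`), and the reduction static ⇒ dynamic
  (`enstrophyRateSupBound_of_stretchingSupBound`, proved: the enstrophy balance of the tree).
  Hölder + the trace-free eigenvalue bound give `C = 2/√3` (filed as the prove target
  `StretchingSupHolder`); whether `2/√3` is OPTIMAL over divergence-free fields is dictionary question
  K1-Q1 (`StretchingSupSharp`, open either way).
* `PalinstrophyLogBudget C c` — the log-door (D4) candidate K1-Q3 for the palinstrophy
  `𝒫 = ‖Δv‖₂²`: `d𝒫/dt ≤ C ‖ω‖_∞ 𝒫 log(e + c 𝒫/ν²)`; in print only at the level `H^m`, `m ≥ 3`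
  (Majda–Bertozzi 2002, Prop. 3.8, (3.83)–(3.84)); it would feed the Beale–Kato–Majda criterion by
  Osgood. Typed in the majorant form of `DoeringGibbon1995_enstrophyRate_le_vorticitySup`.
* `EnstrophyQuadraticBudgetFalse` — K1-Q5: `¬ EnstrophyQuadraticBudget C` for EVERY `C`
  (the no-go seat's three-wave family settles `C < 1/(768π²)`; the full range is open in the tree).

* v1.2 (2026-08-19, after p195731 / p195623 / p195806): `stretchingSupBound_two` (the static bound
  HOLDS with Doering–Gibbon's `2`, from the Literature stretching estimate: tree K1-Q1 window `(0, 2]`,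
  `(0, 2/√3]` once `StretchingSupHolder` lands) and (static ⇒ dynamic ⇒ named fact, end to end,
  = the landed `DoeringGibbon1995_enstrophyRate_le_vorticitySup_holds`); `torusVorticityMoment q` (`Z_q = ∫|ω|^q`) and the K1-Q2 law
  `MiddleEigenvalueMomentRateBound q C`, its `q = 2, C = 2` case PROVED from Miller's Lemma 5.1
  (`middleEigenvalueMomentRateBound_two`); K1-Q5 wired to the prove seat's no-go criterion
  (`enstrophyQuadraticBudgetFalse_of_unbounded`; the unbounded family is door D2b); K1-Q0 for the core
  `𝒫`: `PalinstrophySaturatingLaw κ = SaturatingLaw 𝒫 3 (5/3) κ` and `PalinstrophySaturationFails`.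

* v1.3 (2026-08-19T23:00Z, after p197294 / p197041 / TorusAgmonExplicit / TorusClassicalHnBalance):
  K1-Q5 SETTLED — `enstrophyQuadraticBudgetFalse_fin3` is the tree theorem `not_enstrophyQuadraticBudget`
  (every real `C`, dimension `Fin 3`). K1-Q0(𝒫) DECIDED THE OTHER WAY (dict/LADDER-K1Q0.md): the
  palinstrophy saturating law HOLDS for every `κ ≥ κ_A = (3/4)(5/8)^{5/3}(3√2/π)^{8/3} ≈ 0.7635`
  (`palinstrophyLadderConst`) by the ladder chain production ≤ `3‖∇u‖_∞𝒫` · Agmon for `∇u` ·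
  interpolation `𝒫² ≤ 2ℰ‖∇Δu‖₂²` · a real two-case optimisation; typed here as four prover targets
  (`PalinstrophyProductionSupBound`, `GradientAgmonBound`, `PalinstrophyInterpolation`,
  `LadderRealIneq`) whose conjunction gives `PalinstrophyLadderLaw` by the PROVED assembly
  `palinstrophyLadderLaw_of_bounds` (the `H²` balance `torusPalinstrophy_hasDerivWithinAt` is now a
  theorem of this file, from the tree's `Hⁿ` balances); hence `PalinstrophySaturationFails` is expected
  FALSE (`not_palinstrophySaturationFails_of_bounds`) — v1.2's kill target is withdrawn.

Nothing here is a theorem about Navier–Stokes regularity; every `def … : Prop` is a census row's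
formal reading, and the only `theorem`s are bookkeeping (monotonicity in the constant, calibration
against named facts and tree lemmas, static ⇒ dynamic). FILING NOTE (prove seat, 400-line cap):
the K1-Q5 wiring, `PalinstrophySaturatingLaw` / `PalinstrophySaturationFails` and the whole v1.3
ladder section live in the companion file `PalinstrophyLadder.lean` (same namespace, imports this
file); statements are the dictionary seat's v1.3 text, byte-identical.
-/

noncomputable section

open Set MeasureTheory
open scoped InnerProductSpace RealInnerProductSpace

namespace Summit.NavierStokesRegularity.FunctionalMining

open Literature.Analysis.FunctionSpaces Literature.Analysis.FluidPDE

variable {d : Type*} [Fintype d] [DecidableEq d]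

/-! ## The saturating (Lu–Doering-type) law in the single κ-convention -/

/-- **Saturating law `T_LD_κ(F; σ, γ)` (K0 shape T_LD / family EK, κ-convention of REFEREE F4.2).**
`dF/dt ≤ κ · ν^{-γ} · (2ℰ) · F^{1 + 1/σ}` along every zero-mean classical solution of unforced
Navier–Stokes on `T³` (`IsRateBudget`), where `2ℰ = ‖∇u‖₂² = −K̇/ν` is the full dissipation.
κ is the RATE constant: the law is monotone in κ (`SaturatingLaw.mono_kappa`), it holds for all
fields iff `κ ≥ C_F* := sup Ḟ ν^γ / (2ℰ F^{1+1/σ})`, and `M_F(κ) = K − (σ/κ) ν^{1+γ} F^{-1/σ}` is then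
non-increasing (small-data closing only; DICTIONARY §7). Real powers (`Real.rpow`); for `F ≥ 0`.
Search for candidate a priori estimates; no regularity claim — nothing is asserted. -/
def SaturatingLaw (F : (UnitAddTorus d → EuclideanSpace ℝ d) → ℝ) (σ γ κ : ℝ) : Prop :=
  IsRateBudget (d := d) F
    (fun ν v => κ * ν ^ (-γ) * (2 * torusEnstrophy v) * F v ^ (1 + σ⁻¹))

/-- **Larger κ is the weaker law** (for a non-negative functional): the census sweeps κ DOWNWARD
and the smallest violation-free κ is a lower bound for the optimal constant. [folklore] -/
theorem SaturatingLaw.mono_kappa {F : (UnitAddTorus d → EuclideanSpace ℝ d) → ℝ} {σ γ κ κ' : ℝ}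
    (h : SaturatingLaw (d := d) F σ γ κ) (hF : ∀ v, 0 ≤ F v) (hκ : κ ≤ κ') :
    SaturatingLaw (d := d) F σ γ κ' := by
  refine IsRateBudget.mono h fun ν hν v => ?_
  have ha : 0 ≤ ν ^ (-γ) := Real.rpow_nonneg hν.le _
  have hb : 0 ≤ 2 * torusEnstrophy v := mul_nonneg (by norm_num) (torusEnstrophy_nonneg v)
  have hc : 0 ≤ F v ^ (1 + σ⁻¹) := Real.rpow_nonneg (hF v) _
  have hx : 0 ≤ ν ^ (-γ) * (2 * torusEnstrophy v) * F v ^ (1 + σ⁻¹) :=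
    mul_nonneg (mul_nonneg ha hb) hc
  calc κ * ν ^ (-γ) * (2 * torusEnstrophy v) * F v ^ (1 + σ⁻¹)
      = κ * (ν ^ (-γ) * (2 * torusEnstrophy v) * F v ^ (1 + σ⁻¹)) := by ring
    _ ≤ κ' * (ν ^ (-γ) * (2 * torusEnstrophy v) * F v ^ (1 + σ⁻¹)) :=
        mul_le_mul_of_nonneg_right hκ hx
    _ = κ' * ν ^ (-γ) * (2 * torusEnstrophy v) * F v ^ (1 + σ⁻¹) := by ring

/-- The Lu–Doering budget in the κ-convention: for `ν > 0` and `ℰ ≥ 0`,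
`(27/(16π⁴)) ν^{-3} (2ℰ) ℰ^{1+1/1} = C_LD(ν) ℰ³`. [folklore] -/
theorem luDoering_budget_eq_kappa_form {ν : ℝ} (hν : 0 < ν) (v : UnitAddTorus d → EuclideanSpace ℝ d) :
    27 / (16 * Real.pi ^ 4) * ν ^ (-(3 : ℝ)) * (2 * torusEnstrophy v) *
        torusEnstrophy v ^ (1 + (1 : ℝ)⁻¹) =
      luDoeringConst ν * torusEnstrophy v ^ 3 := by
  have h3 : ν ^ (-(3 : ℝ)) = (ν ^ 3)⁻¹ := by
    rw [Real.rpow_neg hν.le, show (3 : ℝ) = ((3 : ℕ) : ℝ) by norm_num, Real.rpow_natCast]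
  have h2 : torusEnstrophy v ^ (1 + (1 : ℝ)⁻¹) = torusEnstrophy v ^ 2 := by
    rw [show (1 : ℝ) + (1 : ℝ)⁻¹ = ((2 : ℕ) : ℝ) by norm_num, Real.rpow_natCast]
  rw [h3, h2]
  unfold luDoeringConst
  have hπ : Real.pi ≠ 0 := Real.pi_ne_zero
  have hν' : ν ≠ 0 := hν.ne'
  field_simp
  ring

/-- **Calibration: at `κ = 27/(16π⁴)` (`= c_LD/2` in ℰ-units) the saturating law for the enstrophy
IS the Lu–Doering named fact** `dℰ/dt ≤ 27/(8π⁴ν³) ℰ³` (`isRateBudget_torusEnstrophy_cubic_iff`).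
Nothing is asserted about the fact. [folklore] -/
theorem saturatingLaw_enstrophy_iff :
    SaturatingLaw (d := d) torusEnstrophy 1 3 (27 / (16 * Real.pi ^ 4)) ↔
      LuDoering2008_enstrophyRate_le (d := d) := by
  rw [← isRateBudget_torusEnstrophy_cubic_iff]
  unfold SaturatingLaw
  constructor
  · intro h
    refine h.mono fun ν hν v => le_of_eq ?_
    exact luDoering_budget_eq_kappa_form hν v
  · intro h
    refine h.mono fun ν hν v => le_of_eq ?_
    exact (luDoering_budget_eq_kappa_form hν v).symm

/-! ## The static stretching inequality (NOGO N2) and its dynamic form -/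

/-- **Static stretching bound with constant `C` (K0 rows `E.q=2|T_C|C3b`, NOGO N2).** For every
smooth divergence-free velocity field `v` on the unit 3-torus and every pointwise vorticity majorant
`M ≥ 0` (`|ω(x)|² ≤ M²` for all `x`), the enstrophy production satisfies
`∫⟪(v·∇)v, Δv⟫ ≤ C · M · ℰ(v)` (`= C M ‖ω‖₂²/2`). A FIELD inequality: no time, no solution.
Hölder and `λ_max(S)² ≤ (2/3)|S|²`, `‖S‖₂² = ℰ` give `C = 2/√3` (`StretchingSupHolder`); the
optimal constant over divergence-free fields is dictionary question K1-Q1. Search for candidate a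
priori estimates; no regularity claim — nothing is asserted. -/
def StretchingSupBound (C : ℝ) : Prop :=
  Fintype.card d = 3 → ∀ v : UnitAddTorus d → EuclideanSpace ℝ d,
    Torus.IsSmooth v → Torus.IsDivFree v →
      ∀ M : ℝ, 0 ≤ M → (∀ x, torusVorticitySqAt v x ≤ M ^ 2) →
        enstrophyProduction v ≤ C * M * torusEnstrophy v

/-- The static bound is monotone in the constant. [folklore] -/
theorem StretchingSupBound.mono {C C' : ℝ} (h : StretchingSupBound (d := d) C) (hC : C ≤ C') :
    StretchingSupBound (d := d) C' := fun hd v hv hdiv M hM hω =>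
  (h hd v hv hdiv M hM hω).trans
    (mul_le_mul_of_nonneg_right (mul_le_mul_of_nonneg_right hC hM) (torusEnstrophy_nonneg v))

/-- **Prove target (expected TRUE): the Hölder constant `2/√3`.** `|∫ω·Sω| ≤ ‖ω‖_∞ ‖ω‖₂ ‖λ_max(S)‖₂
≤ ‖ω‖_∞ ‖ω‖₂ √(2/3) ‖S‖₂ = (2/√3) ‖ω‖_∞ ℰ` for divergence-free periodic `v` (`‖S‖₂² = ℰ`,
`‖ω‖₂² = 2ℰ`). Not yet in the tree; filed for the prove seat as an open obligation. Nothing is asserted. -/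
@[conjecture] def StretchingSupHolder : Prop :=
  StretchingSupBound (d := d) (2 / Real.sqrt 3)

/-- **K1-Q1 (OPEN either way): is `2/√3` the optimal static constant?** `StretchingSupSharp` says no
constant below `2/√3` works for all smooth divergence-free fields on `T³`. A refutation — an explicit
`C < 2/√3` with `StretchingSupBound C` — would be a new static inequality exploiting incompressibility
beyond Hölder; a proof needs near-extremisers (vorticity aligned with the top strain direction at
constant modulus, which `div v = 0` obstructs). Search for candidate a priori estimates; no
regularity claim — nothing is asserted. -/
@[conjecture] def StretchingSupSharp : Prop :=
  ∀ C : ℝ, StretchingSupBound (d := d) C → 2 / Real.sqrt 3 ≤ C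

/-- **Dynamic form with constant `C`** — literally the shape of the named fact
`DoeringGibbon1995_enstrophyRate_le_vorticitySup` with `2` replaced by `C`: along every classical
solution of unforced Navier–Stokes/Euler (`ν ≥ 0`) on `T³ × [a, b]`, every one-sided derivative value
`R` of the enstrophy at a time where `|ω| ≤ M` pointwise satisfies `R ≤ C M ℰ`. Nothing is asserted. -/
def EnstrophyRateSupBound (C : ℝ) : Prop :=
  Fintype.card d = 3 → ∀ {ν : ℝ}, 0 ≤ ν → ∀ {a b : ℝ}, a < b →
    ∀ {u : ℝ → UnitAddTorus d → EuclideanSpace ℝ d} {p : ℝ → UnitAddTorus d → ℝ},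
      Torus.IsClassicalNSSolutionOn (Icc a b) ν 0 u p →
      ∀ t ∈ Icc a b, ∀ M : ℝ, 0 ≤ M → (∀ x, torusVorticitySqAt (u t) x ≤ M ^ 2) →
        ∀ R : ℝ, HasDerivWithinAt (fun s => torusEnstrophy (u s)) R (Icc a b) t →
          R ≤ C * M * torusEnstrophy (u t)

/-- At `C = 2` the dynamic form is Doering–Gibbon's named fact, by definition. [folklore] -/
theorem enstrophyRateSupBound_two_iff :
    EnstrophyRateSupBound (d := d) 2 ↔ DoeringGibbon1995_enstrophyRate_le_vorticitySup (d := d) :=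
  Iff.rfl

/-- **Static ⇒ dynamic (NOGO N2 reduction, proved).** A static stretching bound with constant `C`
gives the dynamic enstrophy-rate bound with the same constant along every classical solution, by the
tree's enstrophy balance `dℰ/dt = −ν‖Δu‖₂² + ∫⟪(u·∇)u, Δu⟫`
(`Torus.IsClassicalNSSolutionOn.hasDerivWithinAt_half_gradNormSq`) and `ν‖Δu‖₂² ≥ 0`. So the
deciding computation for such rows is field-space ascent, never time stepping. [folklore] -/
theorem enstrophyRateSupBound_of_stretchingSupBound {C : ℝ} (h : StretchingSupBound (d := d) C) :
    EnstrophyRateSupBound (d := d) C := by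
  intro hd ν hν a b hab u p hsol t ht M hM hω R hR
  -- the tree's enstrophy balance, stated for `torusEnstrophy` (definitionally `2⁻¹ * gradNormSq`)
  have hder : HasDerivWithinAt (fun s => torusEnstrophy (u s))
      (-ν * (∫ x, ‖Torus.laplacian (u t) x‖ ^ 2) +
        ∫ x, ⟪Torus.convect (u t) (u t) x - (0 : ℝ → UnitAddTorus d → EuclideanSpace ℝ d) t x,
          Torus.laplacian (u t) x⟫) (Icc a b) t :=
    hsol.hasDerivWithinAt_half_gradNormSq hab ht
  have hRval : R = -ν * (∫ x, ‖Torus.laplacian (u t) x‖ ^ 2) + enstrophyProduction (u t) := by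
    have h1 := hR.derivWithin (uniqueDiffOn_Icc hab t ht)
    have h2 := hder.derivWithin (uniqueDiffOn_Icc hab t ht)
    rw [h1] at h2
    rw [h2]
    simp only [enstrophyProduction, Pi.zero_apply, sub_zero]
  have hvisc : 0 ≤ ν * ∫ x, ‖Torus.laplacian (u t) x‖ ^ 2 :=
    mul_nonneg hν (integral_nonneg fun x => by positivity)
  have hstat := h hd (u t) (hsol.smooth_velocity.isSmooth_slice ht) (hsol.divFree t ht) M hM hω
  rw [hRval]
  linarith

/-! ## The log door (D4): palinstrophy, K1-Q3 -/

/-- The PALINSTROPHY `𝒫(v) = ∫_{T^d} |Δv|² = ‖Δv‖₂²` (`= ‖∇ω‖₂²` for periodic divergence-free `v`;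
the viscous term of the enstrophy balance `dℰ/dt = σ − ν𝒫` is `−ν𝒫`). CONVENTION (referee F6.2): NO
factor `½` — this is DICTIONARY §1's core global `P = ∫|∇ω|²` and the integral written inline in
`QuadraticBudgetStatic` (whose docstring's "twice the palinstrophy" and the bank's column
`P = ⟨|∇ω|²⟩/2` refer to the `½`-convention matching `torusEnstrophy = ½‖∇u‖₂²`): on the unit torus
`𝒫 = 2 · P_bank`, and every constant quoted for a `𝒫`-row carries this factor explicitly (DICTIONARY §13).
Bochner integral, junk `0` if not integrable. Dimension `L·T⁻²`; on the UNIT torus (`L = 1`) `𝒫/ν²` is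
a pure number. -/
def torusPalinstrophy (v : UnitAddTorus d → EuclideanSpace ℝ d) : ℝ :=
  ∫ x, ‖Torus.laplacian v x‖ ^ 2

omit [DecidableEq d] in
/-- Palinstrophy is nonnegative. [folklore] -/
theorem torusPalinstrophy_nonneg (v : UnitAddTorus d → EuclideanSpace ℝ d) :
    0 ≤ torusPalinstrophy v :=
  integral_nonneg fun x => by positivity

/-- **K1-Q3 (log door D4, K0 shape T_CL; OPEN): log-Lipschitz palinstrophy law driven by `‖ω‖_∞`.**
Along every classical solution of unforced Navier–Stokes on `T³ × [a, b]` (`ν > 0`), at every time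
where `|ω| ≤ M` pointwise, every one-sided derivative value `R` of `s ↦ 𝒫(u s)` within `[a, b]`
satisfies `R ≤ C · M · 𝒫 · log(e + c 𝒫/ν²)`. If true for some `C, c` it feeds the
Beale–Kato–Majda criterion by Osgood (`∫ ‖ω‖_∞ dt < ∞ ⇒ 𝒫` bounded ⇒ `H²` control); in print
only at the level `H^m`, `m ≥ 3` (Majda–Bertozzi 2002, Prop. 3.8). This is **K1-Q3(a)** (referee
F6.3): the viscous term `−ν‖∇Δu‖₂²` of the `𝒫` balance is dropped (implied, weaker statement) and the
log argument `𝒫/ν²` is the unit-torus (`L = 1`) normalisation; the census row P0-20 is its proxy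
**K1-Q3(b)** with the fully dimensionless `P̂ = 2L¹²P E³/ν⁸` (bank `½`-conventions) — a DIFFERENT
conjecture on general boxes (the two log arguments differ by the factor `K³/ν⁶`, unbounded a priori), the
same question up to constants only along trajectories with `K` bounded above and below. Majorant form (no
supremum, no junk); the `H²` balance along classical solutions is not yet a tree lemma, so a prover first
supplies the derivative. Search for candidate a priori estimates; no regularity claim — nothing is
asserted. -/
@[conjecture] def PalinstrophyLogBudget (C c : ℝ) : Prop :=
  Fintype.card d = 3 → ∀ {ν : ℝ}, 0 < ν → ∀ {a b : ℝ}, a < b →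
    ∀ {u : ℝ → UnitAddTorus d → EuclideanSpace ℝ d} {p : ℝ → UnitAddTorus d → ℝ},
      Torus.IsClassicalNSSolutionOn (Icc a b) ν 0 u p →
      ∀ t ∈ Icc a b, ∀ M : ℝ, 0 ≤ M → (∀ x, torusVorticitySqAt (u t) x ≤ M ^ 2) →
        ∀ R : ℝ, HasDerivWithinAt (fun s => torusPalinstrophy (u s)) R (Icc a b) t →
          R ≤ C * M * torusPalinstrophy (u t) *
            Real.log (Real.exp 1 + c * torusPalinstrophy (u t) / ν ^ 2)

/-! ## K1-Q5: the quadratic enstrophy budget should fail for every constant -/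

/-- **K1-Q5 (door D2b; OPEN in the tree beyond `C < 1/(768π²)`):** the Grönwall-closable budget
`dℰ/dt ≤ (C/ν) ℰ²` (`EnstrophyQuadraticBudget C`, census row C1) fails for EVERY real `C` — expected
by the space-time scaling sieve (a universal enstrophy budget has degree `3`, not `2`) via a
UV-concentrating divergence-free family with positive production; the no-go seat's fixed three-wave
field settles small `C` only. Search for candidate a priori estimates; no regularity claim — nothing
is asserted. -/
@[conjecture] def EnstrophyQuadraticBudgetFalse : Prop :=
  ∀ C : ℝ, ¬ EnstrophyQuadraticBudget (d := d) C

/-- **K1-Q5 is SETTLED in dimension three (v1.3).** The prove seat's tree theorem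
`not_enstrophyQuadraticBudget` (`QuadraticBudgetRefutation`, p197294 = static reduction p195806 +
certified whole-space bump witness p197041 + dilation/planting p196567) refutes the quadratic
enstrophy budget `dℰ/dt ≤ (C/ν) ℰ²` for EVERY real `C` on `T³ = (ℝ/ℤ)^{Fin 3}`; this is the
dictionary's conjecture at `d := Fin 3` (the general-`d`, `card d = 3` form follows by transport along
`d ≃ Fin 3` and is not spelled out). Census row P0-22 is thereby pure calibration. [folklore] -/
theorem enstrophyQuadraticBudgetFalse_fin3 : EnstrophyQuadraticBudgetFalse (d := Fin 3) :=
  fun C => not_enstrophyQuadraticBudget C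


/-! ## v1.2: the static bound with constant 2 is a tree theorem (K1-Q1 window) -/

/-- **Calibration (PROVED): the static stretching bound holds with Doering–Gibbon's constant `2`** —
the Literature estimate `∫⟪Δv, (v·∇)v⟫ ≤ 2Mℰ(v)` for smooth divergence-free `v` with `|ω| ≤ M`
(`integral_inner_laplacian_convect_le_two_mul_vorticityBound_mul_torusEnstrophy`, Betchov + pointwise
algebra), read in the census's orientation `enstrophyProduction v = ∫⟪(v·∇)v, Δv⟫`. Hence the optimal
static constant of K1-Q1 lies in `(0, 2]` by tree theorems (`(0, 2/√3]` after `StretchingSupHolder`).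
[folklore] -/
theorem stretchingSupBound_two : StretchingSupBound (d := d) 2 := by
  intro hd v hv hdiv M hM hω
  have h := integral_inner_laplacian_convect_le_two_mul_vorticityBound_mul_torusEnstrophy hd hv hdiv hM hω
  have hcomm : enstrophyProduction v = ∫ x, ⟪Torus.laplacian v x, Torus.convect v v x⟫_ℝ := by
    unfold enstrophyProduction
    exact congrArg (fun f : UnitAddTorus d → ℝ => ∫ x, f x)
      (funext fun x => real_inner_comm (Torus.laplacian v x) (Torus.convect v v x))
  rw [hcomm]
  exact h

/- FILING NOTE (prove seat): the dictionary's `doeringGibbon_of_static :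
DoeringGibbon1995_enstrophyRate_le_vorticitySup := enstrophyRateSupBound_two_iff.mp
(enstrophyRateSupBound_of_stretchingSupBound stretchingSupBound_two)` (static ⇒ dynamic ⇒ named fact,
end to end) restates the landed `DoeringGibbon1995_enstrophyRate_le_vorticitySup_holds`
(`FluidPDE/ExtremeGrowthVorticityControlProofs`) and is omitted by the gate's dedup rule; the
two-line derivation above is the second route. -/

/-! ## v1.2: K1-Q2 — vorticity moments `Z_q` against the middle strain eigenvalue -/

/-- The vorticity moment `Z_q(v) = ∫_{T^d} |ω|^q := ∫ (torusVorticitySqAt v x)^{q/2}` (real power;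
K0 core family `E.q`). `Z_2 = ∫|ω|² = 2ℰ` for smooth divergence-free `v` (`torusVorticityMoment_two`).
Bochner integral, junk `0` if not integrable; dimension `L^{3−q}·T^{−q}` on the unit torus. -/
def torusVorticityMoment (q : ℝ) (v : UnitAddTorus d → EuclideanSpace ℝ d) : ℝ :=
  ∫ x, torusVorticitySqAt v x ^ (q / 2)

/-- `Z_q ≥ 0`. [folklore] -/
theorem torusVorticityMoment_nonneg (q : ℝ) (v : UnitAddTorus d → EuclideanSpace ℝ d) :
    0 ≤ torusVorticityMoment q v :=
  integral_nonneg fun x => Real.rpow_nonneg (torusVorticitySqAt_nonneg v x) _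

/-- `Z_2 = 2ℰ` for smooth divergence-free fields (Ayala–Protas (2.4) in the tree,
`integral_torusVorticitySqAt_eq_two_mul_torusEnstrophy`). [folklore] -/
theorem torusVorticityMoment_two {v : UnitAddTorus d → EuclideanSpace ℝ d} (hv : Torus.IsSmooth v)
    (hdiv : Torus.IsDivFree v) : torusVorticityMoment 2 v = 2 * torusEnstrophy v := by
  unfold torusVorticityMoment
  have h2 : (2 : ℝ) / 2 = 1 := by norm_num
  simp only [h2, Real.rpow_one]
  exact integral_torusVorticitySqAt_eq_two_mul_torusEnstrophy hv hdiv

/-- **K1-Q2 (door D2a; K0 rows `E.q≠2|T_C|C3b`; OPEN for every `q ≠ 2`): the middle-eigenvalue law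
for `Z_q`.** Along every classical solution of unforced Navier–Stokes/Euler (`ν ≥ 0`) on `T³ × [a, b]`,
at every time `t` where the middle eigenvalue `λ₂(S(t,x))` of the strain
`S = Matrix.of fun i j => ½((∂ⱼu)ᵢ + (∂ᵢu)ⱼ)` is `≤ Λ` for all `x` (`Λ ≥ 0`; Mathlib's decreasing
`eigenvalues₀`, index `1` of `3`, as in `MillerMiddleEigenvalueTorus`), every one-sided derivative value
`R` of `s ↦ Z_q(u s)` within `[a, b]` at `t` satisfies `R ≤ C Λ Z_q(u t)`. At `q = 2` it holds with
`C = 2` (Betchov + Miller's Lemma 5.1: `middleEigenvalueMomentRateBound_two`, PROVED) and is Miller's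
`‖λ₂⁺‖_∞ ∈ L¹_t` criterion; for `q ≠ 2` the weight `|ω|^{q−2}` destroys the Betchov identity and
`tr S = 0` alone gives no sign structure for `∫|ω|^{q−2} ωᵀSω` (pointwise, plane strain `(L, 0, −L)`
with `ω ∥ e₁` stretches at rate `L` with `λ₂⁺ = 0`). Deciding computation: static ascent on
`q∫|ω|^{q−2}ωᵀSω / (‖λ₂⁺‖_∞ Z_q)` over divergence-free fields (NOGO N2); the static ⇒ dynamic
reduction needs the `Z_q` balance along classical solutions, not yet a tree lemma. Majorant form (no
supremum, no junk). Search for candidate a priori estimates; no regularity claim — nothing is asserted. -/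
@[conjecture] def MiddleEigenvalueMomentRateBound (q C : ℝ) : Prop :=
  ∀ hd : Fintype.card d = 3, ∀ {ν : ℝ}, 0 ≤ ν → ∀ {a b : ℝ}, a < b →
    ∀ {u : ℝ → UnitAddTorus d → EuclideanSpace ℝ d} {p : ℝ → UnitAddTorus d → ℝ},
      Torus.IsClassicalNSSolutionOn (Icc a b) ν 0 u p →
      ∀ t ∈ Icc a b, ∀ Λ : ℝ, 0 ≤ Λ →
        (∀ x, ∀ hx : (Matrix.of fun i j =>
            (Torus.partialDeriv j (u t) x i + Torus.partialDeriv i (u t) x j) / 2).IsHermitian,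
            hx.eigenvalues₀ (Fin.cast hd.symm 1) ≤ Λ) →
        ∀ R : ℝ, HasDerivWithinAt (fun s => torusVorticityMoment q (u s)) R (Icc a b) t →
          R ≤ C * Λ * torusVorticityMoment q (u t)

/-- **Calibration (PROVED): at `q = 2` the middle-eigenvalue law holds with `C = 2`** —
`dZ₂/dt = 2 dℰ/dt ≤ 2(−ν‖Δu‖₂² + 2Λℰ) ≤ 2Λ Z₂`, from the tree's
`IsClassicalNSSolutionOn.enstrophyRate_le_middleEigenvalue_sup` (Miller, Lemma 5.1 / Thm 1.1 at
`q = ∞`, lit p195623) and `Z₂ = 2ℰ`. The K0 row `E.q=2|T_C|C3b` is therefore a control. [folklore] -/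
theorem middleEigenvalueMomentRateBound_two : MiddleEigenvalueMomentRateBound (d := d) 2 2 := by
  intro hd ν hν a b hab u p hsol t ht Λ hΛ0 hΛ R hR
  have hZ : ∀ s ∈ Icc a b, torusVorticityMoment 2 (u s) = 2 * torusEnstrophy (u s) := fun s hs =>
    torusVorticityMoment_two (hsol.smooth_velocity.isSmooth_slice hs) (hsol.divFree s hs)
  -- the enstrophy inherits the derivative `R/2`
  have hE : HasDerivWithinAt (fun s => torusEnstrophy (u s)) (2⁻¹ * R) (Icc a b) t := by
    refine (hR.const_mul (2⁻¹ : ℝ)).congr_of_mem (fun s hs => ?_) ht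
    rw [hZ s hs]
    ring
  have h51 := hsol.enstrophyRate_le_middleEigenvalue_sup hd hab ht hΛ0 hΛ (2⁻¹ * R) hE
  have hdiss : 0 ≤ ν * ∫ x, ‖Torus.laplacian (u t) x‖ ^ 2 :=
    mul_nonneg hν (integral_nonneg fun x => by positivity)
  rw [hZ t ht]
  linarith

end Summit.NavierStokesRegularity.FunctionalMining

end
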